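import Summits.CriticalPhenomena.PercolationContinuityZ3.Theorems.PercNearOneGluingNoHeavyQuantFarBundleWeights
import HarnessLib

/-!
# QUANT lane R8, front "FAR beyond trees", layer one — the BUNDLE DICHOTOMY, graph side IVa: the DETACH and GLUE reweightings

builds on p205010 (kernel theorem, internal audit signed; external expert review pending)

Support file (`--supports stmt-CriticalPhenomena-4575`), seat `prim-quant-p1` (gen 18); memo
`run/shared/lean/prim/quant/prim-quant-p1-g18/FOR-LEAD-UNICYCLIC-TREES.md` §2 (kernel plan §6, file F-B part 4a).
Standard axioms; no sorries.  Two definitions (the detached and the glued weight functions) and their bookkeeping.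

For a pocket `Bundle.IsPocket o p u ℓ₁ Lf` and `w : Sym2 (Fin n) → [0,1]`:
* `Bundle.wDet` — DETACH: `s(u,ℓ₁) ↦ 0`, `s(p,ℓ₁) ↦ w s(p,u) · w s(u,ℓ₁)`;  `Bundle.wGlue` — GLUE: `s(p,u) ↦ w s(p,u) · w s(u,ℓ₁)`, `s(u,ℓ₁) ↦ 1`,
  `s(u,ℓ) ↦ w s(u,ℓ) / w s(u,ℓ₁)` (`ℓ ∈ Lf ∖ ℓ₁`); both agree with `w` elsewhere (`wDet_of_ne`, `wGlue_of_ne`, `…_eq_of_avoid`), keep the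
  vanishing on non-allowed pairs (`wDet_vanish`, `wGlue_vanish`); value lemmas; `z0_eq_mul_erase`, `z1_eq_erase`.
[cite: Grimmett1999, §1.3 p. 10] (product measure); [this work].
-/

noncomputable section

namespace Summit.CriticalPhenomena.PercolationContinuityZ3.Theorems

namespace Quant

namespace Bundle

open Finset MeasureTheory Set
open Literature.Probability.LatticeModels
open Literature.Probability.Percolation
open scoped Classical

variable {n : ℕ}

/-- `z0 I f = (1 − f a) · z0 (I ∖ a) f` for `a ∈ I`. [this work] -/
theorem z0_eq_mul_erase {ι : Type*} [DecidableEq ι] {I : Finset ι} {a : ι} (ha : a ∈ I) (f : ι → ℝ) :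
    z0 I f = (1 - f a) * z0 (I.erase a) f := by
  conv_lhs => rw [← insert_erase ha]
  exact z0_insert (notMem_erase a I) f

/-- `z1 I f = f a · z0 (I ∖ a) f + (1 − f a) · z1 (I ∖ a) f` for `a ∈ I`. [this work] -/
theorem z1_eq_erase {ι : Type*} [DecidableEq ι] {I : Finset ι} {a : ι} (ha : a ∈ I) (f : ι → ℝ) :
    z1 I f = f a * z0 (I.erase a) f + (1 - f a) * z1 (I.erase a) f := by
  conv_lhs => rw [← insert_erase ha]
  exact z1_insert (notMem_erase a I) f

section Step

variable {o p u ℓ₁ : Fin n} {Lf : Finset (Fin n)} (H : IsPocket o p u ℓ₁ Lf) (w : Sym2 (Fin n) → unitInterval)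

/-! ## The two reweightings -/

/-- DETACH: re-hang the heaviest leaf `ℓ₁` at the parent — `s(u,ℓ₁) ↦ 0`, `s(p,ℓ₁) ↦ w s(p,u) · w s(u,ℓ₁)`. [this work] -/
def wDet (p u ℓ₁ : Fin n) (w : Sym2 (Fin n) → unitInterval) : Sym2 (Fin n) → unitInterval :=
  Function.update (Function.update w s(u, ℓ₁) 0) s(p, ℓ₁)
    ⟨(w s(p, u) : ℝ) * w s(u, ℓ₁), unitInterval.mul_mem (w s(p, u)).2 (w s(u, ℓ₁)).2⟩

/-- GLUE: `s(p,u) ↦ w s(p,u) · w s(u,ℓ₁)`, `s(u,ℓ₁) ↦ 1`, lighter leaf pairs `s(u,ℓ) ↦ w s(u,ℓ) / w s(u,ℓ₁)` (projected to `[0,1]`). [this work] -/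
def wGlue (p u ℓ₁ : Fin n) (Lf : Finset (Fin n)) (w : Sym2 (Fin n) → unitInterval) : Sym2 (Fin n) → unitInterval := fun e =>
  if e = s(p, u) then ⟨(w s(p, u) : ℝ) * w s(u, ℓ₁), unitInterval.mul_mem (w s(p, u)).2 (w s(u, ℓ₁)).2⟩
  else if e = s(u, ℓ₁) then 1
  else if e ∈ (Lf.erase ℓ₁).image fun ℓ => s(u, ℓ) then Set.projIcc (0 : ℝ) 1 zero_le_one ((w e : ℝ) / w s(u, ℓ₁))
  else w e

include H

/-! ### Distinctness of the pocket pairs -/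

/-- `s(p,u) ≠ s(p,ℓ₁)`. [this work] -/
theorem ne_pu_pl1 : s(p, u) ≠ s(p, ℓ₁) := by
  intro he
  rcases Sym2.eq_iff.1 he with ⟨-, h2⟩ | ⟨h1, -⟩
  · exact H.uL (by rw [h2]; exact H.l1)
  · exact H.pL (by rw [h1]; exact H.l1)

/-- A leaf pair is not the parent pair. [this work] -/
theorem ne_ul_pu {ℓ : Fin n} (hℓ : ℓ ∈ Lf) : s(u, ℓ) ≠ s(p, u) := by
  intro he
  rcases Sym2.eq_iff.1 he with ⟨h1, -⟩ | ⟨-, h2⟩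
  · exact H.pu h1.symm
  · exact H.pL (by rw [← h2]; exact hℓ)

/-- A leaf pair is not `s(p,ℓ₁)`. [this work] -/
theorem ne_ul_pl1 {ℓ : Fin n} (hℓ : ℓ ∈ Lf) : s(u, ℓ) ≠ s(p, ℓ₁) := by
  intro he
  have _ := hℓ
  rcases Sym2.eq_iff.1 he with ⟨h1, -⟩ | ⟨h1, -⟩
  · exact H.pu h1.symm
  · exact H.uL (by rw [h1]; exact H.l1)

omit H in
/-- Leaf pairs are indexed injectively by their leaves. [this work] -/
theorem ul_eq_iff {ℓ ℓ' : Fin n} : s(u, ℓ) = s(u, ℓ') ↔ ℓ = ℓ' := by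
  constructor
  · intro he
    rcases Sym2.eq_iff.1 he with ⟨-, h2⟩ | ⟨h1, h2⟩
    · exact h2
    · exact h2.trans h1
  · rintro rfl; rfl

/-! ### Values of `wDet` -/

/-- `wDet s(u,ℓ₁) = 0`. [this work] -/
theorem wDet_ul1 : (wDet p u ℓ₁ w s(u, ℓ₁) : ℝ) = 0 := by
  unfold wDet
  rw [Function.update_of_ne (ne_ul_pl1 H H.l1), Function.update_self]; rfl

omit H in
/-- `wDet s(p,ℓ₁) = w s(p,u) · w s(u,ℓ₁)`. [this work] -/
theorem wDet_pl1 : (wDet p u ℓ₁ w s(p, ℓ₁) : ℝ) = (w s(p, u) : ℝ) * w s(u, ℓ₁) := by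
  unfold wDet; rw [Function.update_self]

omit H in
/-- `wDet` agrees with `w` off the two reweighted pairs. [this work] -/
theorem wDet_of_ne {e : Sym2 (Fin n)} (h1 : e ≠ s(u, ℓ₁)) (h2 : e ≠ s(p, ℓ₁)) : wDet p u ℓ₁ w e = w e := by
  unfold wDet; rw [Function.update_of_ne h2, Function.update_of_ne h1]

/-- `wDet s(p,u) = w s(p,u)`. [this work] -/
theorem wDet_pu : wDet p u ℓ₁ w s(p, u) = w s(p, u) := wDet_of_ne w (ne_ul_pu H H.l1).symm (ne_pu_pl1 H)

/-- `wDet` keeps the lighter leaf pairs. [this work] -/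
theorem wDet_ul {ℓ : Fin n} (hℓ : ℓ ∈ Lf.erase ℓ₁) : wDet p u ℓ₁ w s(u, ℓ) = w s(u, ℓ) :=
  wDet_of_ne w (fun h => (mem_erase.1 hℓ).1 (ul_eq_iff.1 h)) (ne_ul_pl1 H (mem_erase.1 hℓ).2)

/-! ### Values of `wGlue` -/

omit H in
/-- `wGlue s(p,u) = w s(p,u) · w s(u,ℓ₁)`. [this work] -/
theorem wGlue_pu : (wGlue p u ℓ₁ Lf w s(p, u) : ℝ) = (w s(p, u) : ℝ) * w s(u, ℓ₁) := by
  unfold wGlue; rw [if_pos rfl]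

/-- `wGlue s(u,ℓ₁) = 1`. [this work] -/
theorem wGlue_ul1 : (wGlue p u ℓ₁ Lf w s(u, ℓ₁) : ℝ) = 1 := by
  unfold wGlue; rw [if_neg (ne_ul_pu H H.l1), if_pos rfl]; rfl

/-- `wGlue s(u,ℓ) = w s(u,ℓ) / w s(u,ℓ₁)` on the lighter leaves. [this work] -/
theorem wGlue_ul (hmax : ∀ ℓ ∈ Lf, (w s(u, ℓ) : ℝ) ≤ w s(u, ℓ₁)) (hp1 : 0 < (w s(u, ℓ₁) : ℝ)) {ℓ : Fin n} (hℓ : ℓ ∈ Lf.erase ℓ₁) :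
    (wGlue p u ℓ₁ Lf w s(u, ℓ) : ℝ) = (w s(u, ℓ) : ℝ) / w s(u, ℓ₁) := by
  unfold wGlue
  have h3 : s(u, ℓ) ∈ (Lf.erase ℓ₁).image fun ℓ => s(u, ℓ) := Finset.mem_image_of_mem (fun ℓ => s(u, ℓ)) hℓ
  rw [if_neg (ne_ul_pu H (mem_erase.1 hℓ).2), if_neg (fun h => (mem_erase.1 hℓ).1 (ul_eq_iff.1 h)), if_pos h3,
    Set.projIcc_of_mem _ (unitInterval.div_mem (w s(u, ℓ)).2.1 hp1.le (hmax ℓ (mem_erase.1 hℓ).2))]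

omit H in
/-- `wGlue` agrees with `w` off the reweighted pairs. [this work] -/
theorem wGlue_of_ne {e : Sym2 (Fin n)} (h1 : e ≠ s(p, u)) (h2 : e ≠ s(u, ℓ₁)) (h3 : e ∉ (Lf.erase ℓ₁).image fun ℓ => s(u, ℓ)) :
    wGlue p u ℓ₁ Lf w e = w e := by
  unfold wGlue; rw [if_neg h1, if_neg h2, if_neg h3]

/-- `wGlue s(p,ℓ₁) = w s(p,ℓ₁)`. [this work] -/
theorem wGlue_pl1 : wGlue p u ℓ₁ Lf w s(p, ℓ₁) = w s(p, ℓ₁) :=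
  wGlue_of_ne w (ne_pu_pl1 H).symm (ne_ul_pl1 H H.l1).symm (l1Pair_notMem_image H _ (erase_subset ℓ₁ Lf))

/-! ### Agreement off the pocket pairs; the vanishing hypotheses -/

/-- A pair avoiding `Z` is none of the reweighted pairs. [this work] -/
theorem wDet_eq_of_avoid {e : Sym2 (Fin n)} (he : e ∈ avoid (insert u Lf)) : wDet p u ℓ₁ w e = w e := by
  have hu : u ∉ e := (mem_filter.1 he).2 u (mem_insert_self u Lf)
  refine wDet_of_ne w (fun h => hu (h ▸ Sym2.mem_mk_left u ℓ₁)) (fun h => ?_)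
  exact (mem_filter.1 he).2 ℓ₁ (mem_insert_of_mem H.l1) (h ▸ Sym2.mem_mk_right p ℓ₁)

omit H in
/-- `wGlue` agrees with `w` on the pairs avoiding `Z`. [this work] -/
theorem wGlue_eq_of_avoid {e : Sym2 (Fin n)} (he : e ∈ avoid (insert u Lf)) : wGlue p u ℓ₁ Lf w e = w e := by
  have hu : u ∉ e := (mem_filter.1 he).2 u (mem_insert_self u Lf)
  refine wGlue_of_ne w (fun h => hu (h ▸ Sym2.mem_mk_right p u)) (fun h => hu (h ▸ Sym2.mem_mk_left u ℓ₁)) (fun h => ?_)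
  obtain ⟨ℓ, -, hℓe⟩ := mem_image.1 h
  exact hu (hℓe ▸ Sym2.mem_mk_left u ℓ)

variable (hw0 : ∀ x y : Fin n, x ≠ y → (x ∈ insert u Lf ∨ y ∈ insert u Lf) → ¬ Allowed p u ℓ₁ Lf s(x, y) → (w s(x, y) : ℝ) = 0)
include hw0

/-- `wDet` vanishes on the non-allowed pairs at the pocket (as `w` does). [this work] -/
theorem wDet_vanish : ∀ x y : Fin n, x ≠ y → (x ∈ insert u Lf ∨ y ∈ insert u Lf) → ¬ Allowed p u ℓ₁ Lf s(x, y) →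
    (wDet p u ℓ₁ w s(x, y) : ℝ) = 0 := by
  intro x y hxy hZ hna
  have h1 : s(x, y) ≠ s(u, ℓ₁) := fun h => hna (Or.inr (Or.inr ⟨ℓ₁, H.l1, h⟩))
  have h2 : s(x, y) ≠ s(p, ℓ₁) := fun h => hna (Or.inr (Or.inl h))
  rw [wDet_of_ne w h1 h2]; exact hw0 x y hxy hZ hna

/-- `wGlue` vanishes on the non-allowed pairs at the pocket (as `w` does). [this work] -/
theorem wGlue_vanish : ∀ x y : Fin n, x ≠ y → (x ∈ insert u Lf ∨ y ∈ insert u Lf) → ¬ Allowed p u ℓ₁ Lf s(x, y) →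
    (wGlue p u ℓ₁ Lf w s(x, y) : ℝ) = 0 := by
  intro x y hxy hZ hna
  have h1 : s(x, y) ≠ s(p, u) := fun h => hna (Or.inl h)
  have h2 : s(x, y) ≠ s(u, ℓ₁) := fun h => hna (Or.inr (Or.inr ⟨ℓ₁, H.l1, h⟩))
  have h3 : s(x, y) ∉ (Lf.erase ℓ₁).image fun ℓ => s(u, ℓ) := by
    intro h
    obtain ⟨ℓ, hℓ, hℓe⟩ := mem_image.1 h
    exact hna (Or.inr (Or.inr ⟨ℓ, (mem_erase.1 hℓ).2, hℓe.symm⟩))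
  rw [wGlue_of_ne w h1 h2 h3]; exact hw0 x y hxy hZ hna

end Step

end Bundle

end Quant

end Summit.CriticalPhenomena.PercolationContinuityZ3.Theorems
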